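import Literature.Computability.AlgebraicComplexity.BI17KronRectComplementSymmetry
import Literature.Computability.AlgebraicComplexity.BI17GenericPeriodOddFormatsProofs
import HarnessLib

/-!
# The generic minimal degree `e(m)` of tensor invariants just below a perfect square:
# `e(δ² - j) = (δ² - j)·δ` for `j ≤ 6`, except the odd anomaly `j = 2`

Topic `Literature/Computability/AlgebraicComplexity`; theorem-only consequences of the COMPLEMENT
SYMMETRY `k_m(δ) = k_{δ²-m}(δ)` (`kronRect_eq_kronRect_of_add_eq_sq`,
`BI17KronRectComplementSymmetry.lean`) for the objects of P. Bürgisser, C. Ikenmeyer, *Fundamental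
invariants of orbit closures*, J. Algebra 477 (2017) §5 (= arXiv:1511.02927): the rectangular
Kronecker coefficients `k_m(δ)` (`kronRect ℂ m δ`), the generic degree monoid
`E(m) = {mδ : k_m(δ) > 0}` of `SL_m³`-invariants on `⊗³ℂ^m` (`genericTensorDegreeMonoid_eq_kronRect`)
and the generic minimal degree `e(m)` (`genericTensorMinimalDegree (Fin m) ℂ`). NO new facts, NO
definitions (cell val-lit, unit val-lit-p4 g6).

BI determine `e(m)` for `m ≤ 16` (Ex. 5.6, with the Derksen program) and `e(n²) = n³`
(Thm. 5.9 (3)), and ask for the structure of `E(m)` in general (Problem 5.19). Reading the tree's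
small values `k_1(δ) > 0`, `k_2(δ) = [δ even]` (Rem. 5.4, `BI2017_rem_5_4_holds`), `k_3(δ), k_4(δ) > 0`
(`δ ≠ 1`, Ex. 5.5/5.6), `k_5(δ), k_6(δ) > 0` (`δ ≥ 3`) through the complement symmetry gives the top
of every box:

* `kronRect_sq_sub_one_pos` … `kronRect_sq_sub_six_pos`: **`k_{δ²-j}(δ) > 0` for `j = 1, 3, 4`
  (`δ ≥ 2`), `j = 5, 6` (`δ ≥ 3`)**, and **`k_{δ²-2}(δ) = [δ even]`** (`kronRect_sq_sub_two`; in
  particular the VANISHING `k_{δ²-2}(δ) = 0` for odd `δ ≥ 3` — e.g. `k_7(3) = 0` (BI Ex. 5.6),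
  `k_23(5) = 0`, `k_47(7) = 0` — which lies outside the range `m > δ²` of Thm. 5.9 (1));
* hence, by the location lemma `genericTensorMinimalDegree_eq_of_kronRect_pos` (`(δ-1)² < m`):
  **`e(δ²-1) = (δ²-1)δ` (`δ ≥ 2`), `e(δ²-2) = (δ²-2)δ` (`δ ≥ 2` even), `e(δ²-3) = (δ²-3)δ` and
  `e(δ²-4) = (δ²-4)δ` (`δ ≥ 3`), `e(δ²-5) = (δ²-5)δ` and `e(δ²-6) = (δ²-6)δ` (`δ ≥ 4`)**; these
  contain BI's printed `e(5) = 15, e(6) = 18, e(8) = 24, e(10) = 40, …, e(15) = 60` and continue with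
  `e(19) = 95, e(20) = 100, e(21) = 105, e(22) = 110, e(24) = 120` (`δ = 5`), `e(30) = 180, …`;
* (§4, appended) the general principle `genericTensorMinimalDegree_sq_sub_eq`: `e(δ²-j) = (δ²-j)δ`
  whenever `k_j(δ) > 0` and `j + 2 ≤ 2δ`; with the semigroup property in `δ`: `e(27) = 162`,
  `e(28) = 168`, `e(40) = 280`, `e(42) = 294`, …, and the complete box `e(m) = 8m` for `50 ≤ m ≤ 64`;
* the ODD ANOMALY: for odd `δ ≥ 3`, `δ ∉ E'(δ²-2)` although `(δ-1)² < δ²-2`, so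
  **`e(δ²-2) ≥ (δ²-2)(δ+1)`** (`le_genericTensorMinimalDegree_sq_sub_two_of_odd`) — BI's `e'(7) = 4`
  (`= 3 + 1`, Ex. 5.6) is its first instance; the next are `e'(23) ≥ 6`, `e'(47) ≥ 8`.

IN PRINT (located by val-lit-t08 g6 after this file landed): Li–Zhang–Xia 2021 Thm. 3.1 proves
`k_{n²-j}(n) = k_j(n)` and `δ(n²-1) = n`, `δ(n²-2) = n` (`n` even), `δ(n²-3) = n` (`n ≥ 3`) — i.e.
§2's `j ≤ 3` items and §3's `e(δ²-1)`, `e(δ²-2)` (even), `e(δ²-3)`; Amanov–Yeliussizov 2022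
Thm. 1.1 (ii) prints `δ_3(n) = n⌈√n⌉` for `n ∈ {k²-1, k²}` and Thm. 5.1 (ii) the symmetry. The
`j = 4, 5, 6` families, the odd-anomaly LOWER BOUND and the boxes `δ = 7, 8` of §4 are, as far as the
cell has read, tree-only consequences.

Honest framing: elementary consequences (for the published objects of BI 2017 §5) of classical
character theory already in the tree; the values beyond `m = 16` are stated here as what the tree
proves (with the printed overlaps just listed); nothing here bears on VP versus VNP.

## References
* [BurgisserIkenmeyer2017] P. Bürgisser, C. Ikenmeyer, J. Algebra 477 (2017), §5: eq. (5.2),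
  Rem. 5.4, Ex. 5.5, Ex. 5.6, Thm. 5.9, Rem. 5.18, Problem 5.19 (arXiv:1511.02927 pp. 17–21).
* [IkenmeyerMulmuleyWalter2017] C. Ikenmeyer, K. D. Mulmuley, M. Walter, Comput. Complexity 26
  (2017), Lemma 2.1–2.2 (the `Λ(ℂ^δ ⊗ ℂ^δ ⊗ ℂ^δ)` model behind the complement symmetry).
* [LiZhangXia2021] X. Li, L. Zhang, H. Xia, arXiv:2111.07343, Thm. 3.1.
* [AmanovYeliussizov2022] A. Amanov, D. Yeliussizov, IMRN 2023 = arXiv:2202.11059, Thm. 1.1 (ii),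
  Thm. 5.1 (ii).

## Mathlib and tree
Tree: `kronRect_eq_kronRect_of_add_eq_sq` (`BI17KronRectComplementSymmetry`); `kronRect_zero_pos`,
`kronRect_add_pos` (`BI17GenericPeriodPolystableWitnessProofs`); `kronRect_self_pos`
(`BI17GenericPeriodOddFormatsProofs`); `BI2017_rem_5_4_holds` (`BI17Rem54OfBLMW11Prop81`);
`kronRect_three_pos`, `kronRect_four_pos`, `kronRect_eq_zero_of_sq_lt`,
`genericTensorMinimalDegree_eq_of_kronRect_pos`, `genericTensorDegreeMonoid_eq_kronRect`
(`BI17SL3InvariantDimensionProofs`); `kronRect_five_pos_of_three_le`, `kronRect_six_pos_of_three_le`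
(`BI17Ex56SmallCases`); `kroneckerCoeff_indiscrete_pos` (`KroneckerOneRow`). Mathlib:
`Nat.Partition.indiscrete_parts`.

Provenance: val-lit cell, prover val-lit-p4 g6 (E1 follow-up).
-/

open _root_.Literature.NumberTheory.DiophantineGeometry

namespace Literature.Computability.AlgebraicComplexity

/-! ### 1. `k_1(δ) > 0` -/

section One

/-- Kronecker coefficients only depend on the multisets of parts (transport along equal sizes;
plumbing). [folklore] -/
private theorem kroneckerCoeff_eq_of_parts_eq' {m m' : ℕ} {a b c : Nat.Partition m}
    {a' b' c' : Nat.Partition m'} (ha : a.parts = a'.parts) (hb : b.parts = b'.parts)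
    (hc : c.parts = c'.parts) : kroneckerCoeff ℂ a b c = kroneckerCoeff ℂ a' b' c' := by
  obtain rfl : m = m' := by rw [← a.parts_sum, ha, a'.parts_sum]
  obtain rfl : a = a' := Nat.Partition.ext ha
  obtain rfl : b = b' := Nat.Partition.ext hb
  obtain rfl : c = c' := Nat.Partition.ext hc
  rfl

/-- The rectangle `1 × δ` is the one-row partition `(δ)` (same multiset of parts).
[cite: BurgisserIkenmeyer2017, §5 (before eq. (5.2))] -/
theorem parts_rectangle_one (δ : ℕ) (hδ : δ ≠ 0) :
    (Nat.Partition.rectangle 1 δ).parts = (Nat.Partition.indiscrete δ).parts := by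
  rw [Nat.Partition.parts_rectangle, Nat.Partition.indiscrete_parts hδ, Multiset.replicate_one]
  exact Multiset.filter_eq_self.2 fun a ha => by rwa [Multiset.mem_singleton.1 ha]

/-- **`k_1(δ) > 0`** for every `δ` (`g((δ),(δ),(δ)) = 1`: the trivial representation; `k_1(0) = 1`).
[cite: BurgisserIkenmeyer2017, §5 eq. (5.2)] -/
theorem kronRect_one_pos (δ : ℕ) : 0 < kronRect ℂ 1 δ := by
  rcases Nat.eq_zero_or_pos δ with rfl | hδ
  · exact kronRect_zero_pos one_pos
  · unfold kronRect
    rw [kroneckerCoeff_eq_of_parts_eq' (parts_rectangle_one δ hδ.ne') (parts_rectangle_one δ hδ.ne')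
      (parts_rectangle_one δ hδ.ne')]
    exact kroneckerCoeff_indiscrete_pos ℂ (Nat.Partition.indiscrete δ)

end One

/-! ### 2. The top of the box: `k_{δ²-j}(δ)` for `j ≤ 6` -/

section TopOfBox

/-- **`k_{δ²-1}(δ) > 0`** (`= k_1(δ)`), `δ ≥ 1` (Li–Zhang–Xia Thm. 3.1: `k_{n²-1}(n) = 1`). [cite: LiZhangXia2021, Thm. 3.1] -/
theorem kronRect_sq_sub_one_pos {δ : ℕ} (hδ : 1 ≤ δ) : 0 < kronRect ℂ (δ * δ - 1) δ := by
  rw [← kronRect_eq_kronRect_sq_sub (m := 1) (by nlinarith)]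
  exact kronRect_one_pos δ

/-- **`k_{δ²-2}(δ) = [δ even]`** (`= k_2(δ)`, BI Rem. 5.4), `δ ≥ 2`: in particular
`k_{δ²-2}(δ) = 0` for odd `δ ≥ 3` (`k_7(3) = 0`, `k_23(5) = 0`, `k_47(7) = 0`, …), a vanishing
outside the range `m > δ²` of Thm. 5.9 (1) (Li–Zhang–Xia Thm. 3.1 with Tewari 2015; Amanov–Yeliussizov §5).
[cite: LiZhangXia2021, Thm. 3.1] -/
theorem kronRect_sq_sub_two {δ : ℕ} (hδ : 2 ≤ δ) :
    kronRect ℂ (δ * δ - 2) δ = if Even δ then 1 else 0 := by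
  rw [← kronRect_eq_kronRect_sq_sub (m := 2) (by nlinarith)]
  exact BI2017_rem_5_4_holds.1 δ

/-- `k_{δ²-2}(δ) > 0` for even `δ ≥ 2`. [cite: BurgisserIkenmeyer2017, Rem. 5.4] -/
theorem kronRect_sq_sub_two_pos_of_even {δ : ℕ} (hδ : 2 ≤ δ) (he : Even δ) :
    0 < kronRect ℂ (δ * δ - 2) δ := by
  rw [kronRect_sq_sub_two hδ, if_pos he]
  exact one_pos

/-- **`k_{δ²-2}(δ) = 0` for odd `δ ≥ 3`.** [cite: BurgisserIkenmeyer2017, Rem. 5.4] -/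
theorem kronRect_sq_sub_two_eq_zero_of_odd {δ : ℕ} (hδ : 3 ≤ δ) (ho : Odd δ) :
    kronRect ℂ (δ * δ - 2) δ = 0 := by
  rw [kronRect_sq_sub_two (by omega), if_neg (Nat.not_even_iff_odd.2 ho)]

/-- **`k_{δ²-3}(δ) > 0`** (`= k_3(δ) > 0` for `δ ≠ 1`, BI Ex. 5.5), `δ ≥ 2` (Li–Zhang–Xia Thm. 3.1). [cite: LiZhangXia2021, Thm. 3.1] -/
theorem kronRect_sq_sub_three_pos {δ : ℕ} (hδ : 2 ≤ δ) : 0 < kronRect ℂ (δ * δ - 3) δ := by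
  rw [← kronRect_eq_kronRect_sq_sub (m := 3) (by nlinarith)]
  exact kronRect_three_pos (by omega)

/-- **`k_{δ²-4}(δ) > 0`** (`= k_4(δ) > 0` for `δ ≠ 1`, BI Ex. 5.6), `δ ≥ 2`. [cite: BurgisserIkenmeyer2017, Ex. 5.6] -/
theorem kronRect_sq_sub_four_pos {δ : ℕ} (hδ : 2 ≤ δ) : 0 < kronRect ℂ (δ * δ - 4) δ := by
  rw [← kronRect_eq_kronRect_sq_sub (m := 4) (by nlinarith)]
  exact kronRect_four_pos (by omega)

/-- **`k_{δ²-5}(δ) > 0`** (`= k_5(δ) > 0` for `δ ≥ 3`, BI Ex. 5.6), `δ ≥ 3`. [cite: BurgisserIkenmeyer2017, Ex. 5.6] -/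
theorem kronRect_sq_sub_five_pos {δ : ℕ} (hδ : 3 ≤ δ) : 0 < kronRect ℂ (δ * δ - 5) δ := by
  rw [← kronRect_eq_kronRect_sq_sub (m := 5) (by nlinarith)]
  exact kronRect_five_pos_of_three_le hδ

/-- **`k_{δ²-6}(δ) > 0`** (`= k_6(δ) > 0` for `δ ≥ 3`, BI Ex. 5.6), `δ ≥ 3`. [cite: BurgisserIkenmeyer2017, Ex. 5.6] -/
theorem kronRect_sq_sub_six_pos {δ : ℕ} (hδ : 3 ≤ δ) : 0 < kronRect ℂ (δ * δ - 6) δ := by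
  rw [← kronRect_eq_kronRect_sq_sub (m := 6) (by nlinarith)]
  exact kronRect_six_pos_of_three_le hδ

end TopOfBox

/-! ### 3. The generic minimal degree just below a perfect square -/

section MinimalDegree

/-- `(δ-1)² < δ² - j` as soon as `j + 2 ≤ 2δ` (plumbing for the location lemma). [folklore] -/
private theorem sq_pred_lt_sq_sub {δ j : ℕ} (h : j + 2 ≤ 2 * δ) (hδ : 1 ≤ δ) :
    (δ - 1) ^ 2 < δ * δ - j := by
  obtain ⟨e, rfl⟩ : ∃ e, δ = e + 1 := ⟨δ - 1, (Nat.sub_add_cancel hδ).symm⟩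
  rw [Nat.add_sub_cancel]
  have h1 : (e + 1) * (e + 1) = e ^ 2 + 2 * e + 1 := by ring
  rw [h1]
  omega

/-- **`e(δ²-1) = (δ²-1)·δ`** for `δ ≥ 2` (`k_{δ²-1}(δ) > 0` and `(δ-1)² < δ²-1`): BI's `e(3) = 6`,
`e(8) = 24`, `e(15) = 60`, then `e(24) = 120`, `e(35) = 210`, …. [cite: BurgisserIkenmeyer2017, Ex. 5.6] -/
theorem genericTensorMinimalDegree_sq_sub_one {δ : ℕ} (hδ : 2 ≤ δ) :
    genericTensorMinimalDegree (Fin (δ * δ - 1)) ℂ = (δ * δ - 1) * δ :=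
  genericTensorMinimalDegree_eq_of_kronRect_pos
    (Nat.sub_pos_of_lt (by nlinarith)) (by omega) (kronRect_sq_sub_one_pos (by omega))
    (sq_pred_lt_sq_sub (by omega) (by omega))

/-- **`e(δ²-2) = (δ²-2)·δ` for EVEN `δ ≥ 2`** (`k_{δ²-2}(δ) = 1`): BI's `e(14) = 56` (and `e(2) = 4`,
Rem. 5.4), then `e(34) = 204`, `e(62) = 496`, …. [cite: BurgisserIkenmeyer2017, Ex. 5.6] -/
theorem genericTensorMinimalDegree_sq_sub_two_of_even {δ : ℕ} (hδ : 2 ≤ δ) (he : Even δ) :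
    genericTensorMinimalDegree (Fin (δ * δ - 2)) ℂ = (δ * δ - 2) * δ :=
  genericTensorMinimalDegree_eq_of_kronRect_pos
    (Nat.sub_pos_of_lt (by nlinarith)) (by omega) (kronRect_sq_sub_two_pos_of_even hδ he)
    (sq_pred_lt_sq_sub (by omega) (by omega))

/-- **`e(δ²-3) = (δ²-3)·δ`** for `δ ≥ 3` (`k_{δ²-3}(δ) > 0`, `(δ-1)² < δ²-3`): BI's `e(6) = 18`,
`e(13) = 52`, then `e(22) = 110`, `e(33) = 198`, …. [cite: BurgisserIkenmeyer2017, Ex. 5.6] -/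
theorem genericTensorMinimalDegree_sq_sub_three {δ : ℕ} (hδ : 3 ≤ δ) :
    genericTensorMinimalDegree (Fin (δ * δ - 3)) ℂ = (δ * δ - 3) * δ :=
  genericTensorMinimalDegree_eq_of_kronRect_pos
    (Nat.sub_pos_of_lt (by nlinarith)) (by omega) (kronRect_sq_sub_three_pos (by omega))
    (sq_pred_lt_sq_sub (by omega) (by omega))

/-- **`e(δ²-4) = (δ²-4)·δ`** for `δ ≥ 3`: BI's `e(5) = 15`, `e(12) = 48`, then `e(21) = 105`,
`e(32) = 192`, …. [cite: BurgisserIkenmeyer2017, Ex. 5.6] -/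
theorem genericTensorMinimalDegree_sq_sub_four {δ : ℕ} (hδ : 3 ≤ δ) :
    genericTensorMinimalDegree (Fin (δ * δ - 4)) ℂ = (δ * δ - 4) * δ :=
  genericTensorMinimalDegree_eq_of_kronRect_pos
    (Nat.sub_pos_of_lt (by nlinarith)) (by omega) (kronRect_sq_sub_four_pos (by omega))
    (sq_pred_lt_sq_sub (by omega) (by omega))

/-- **`e(δ²-5) = (δ²-5)·δ`** for `δ ≥ 4`: BI's `e(11) = 44`, then `e(20) = 100`, `e(31) = 186`, ….
(For `δ = 3` the value is `e(4) = 8`: `(δ-1)² < δ²-5` fails.) [cite: BurgisserIkenmeyer2017, Ex. 5.6] -/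
theorem genericTensorMinimalDegree_sq_sub_five {δ : ℕ} (hδ : 4 ≤ δ) :
    genericTensorMinimalDegree (Fin (δ * δ - 5)) ℂ = (δ * δ - 5) * δ :=
  genericTensorMinimalDegree_eq_of_kronRect_pos
    (Nat.sub_pos_of_lt (by nlinarith)) (by omega) (kronRect_sq_sub_five_pos (by omega))
    (sq_pred_lt_sq_sub (by omega) (by omega))

/-- **`e(δ²-6) = (δ²-6)·δ`** for `δ ≥ 4`: BI's `e(10) = 40`, then `e(19) = 95`, `e(30) = 180`, ….
[cite: BurgisserIkenmeyer2017, Ex. 5.6] -/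
theorem genericTensorMinimalDegree_sq_sub_six {δ : ℕ} (hδ : 4 ≤ δ) :
    genericTensorMinimalDegree (Fin (δ * δ - 6)) ℂ = (δ * δ - 6) * δ :=
  genericTensorMinimalDegree_eq_of_kronRect_pos
    (Nat.sub_pos_of_lt (by nlinarith)) (by omega) (kronRect_sq_sub_six_pos (by omega))
    (sq_pred_lt_sq_sub (by omega) (by omega))

/-- **A lower bound for the generic minimal degree from a vanishing list**: if `k_m(δ') = 0` for all
`0 < δ' ≤ δ` (`m ≥ 1`), then `e(m) ≥ m(δ+1)` — the set `E(m) ∖ {0} = {mδ' : k_m(δ') > 0}` is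
non-empty (`k_m(m) > 0`, `kronRect_self_pos`) and contains no `mδ'` with `δ' ≤ δ`.
[cite: BurgisserIkenmeyer2017, §5 eq. (5.2)] -/
theorem le_genericTensorMinimalDegree_of_forall_eq_zero {m δ : ℕ} (hm : 0 < m)
    (hzero : ∀ δ' : ℕ, 0 < δ' → δ' ≤ δ → kronRect ℂ m δ' = 0) :
    m * (δ + 1) ≤ genericTensorMinimalDegree (Fin m) ℂ := by
  unfold genericTensorMinimalDegree
  rw [genericTensorDegreeMonoid_eq_kronRect m]
  have hmem : m * m ∈ {d | d ∈ {d | ∃ δ : ℕ, d = m * δ ∧ 0 < kronRect ℂ m δ} ∧ 0 < d} :=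
    ⟨⟨m, rfl, kronRect_self_pos m hm⟩, Nat.mul_pos hm hm⟩
  refine le_csInf ⟨_, hmem⟩ ?_
  rintro d ⟨⟨δ', rfl, hδ'⟩, hd⟩
  have hδ'0 : 0 < δ' := Nat.pos_of_ne_zero (by rintro rfl; simp at hd)
  refine Nat.mul_le_mul_left m ?_
  by_contra hlt
  rw [hzero δ' hδ'0 (by omega)] at hδ'
  exact lt_irrefl 0 hδ'

/-- **The odd anomaly: `e(δ²-2) ≥ (δ²-2)(δ+1)` for odd `δ ≥ 3`** — `k_{δ²-2}(δ') = 0` for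
`δ' < δ` (`δ'² ≤ (δ-1)² < δ²-2`, Thm. 5.9 (1)) AND for `δ' = δ` (`k_{δ²-2}(δ) = k_2(δ) = 0`, Rem. 5.4
through the complement symmetry). BI's `e'(7) = 4 = 3 + 1` (Ex. 5.6) is the case `δ = 3`; next
`e'(23) ≥ 6`, `e'(47) ≥ 8`. [cite: BurgisserIkenmeyer2017, Ex. 5.6] -/
theorem le_genericTensorMinimalDegree_sq_sub_two_of_odd {δ : ℕ} (hδ : 3 ≤ δ) (ho : Odd δ) :
    (δ * δ - 2) * (δ + 1) ≤ genericTensorMinimalDegree (Fin (δ * δ - 2)) ℂ := by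
  refine le_genericTensorMinimalDegree_of_forall_eq_zero (Nat.sub_pos_of_lt (by nlinarith))
    fun δ' hδ'0 hδ' => ?_
  rcases hδ'.lt_or_eq with hlt | rfl
  · refine kronRect_eq_zero_of_sq_lt ℂ hδ'0 (Nat.lt_sub_of_add_lt ?_)
    have h1 : δ' + 1 ≤ δ := hlt
    have h2 : (δ' + 1) * (δ' + 1) ≤ δ * δ := Nat.mul_le_mul h1 h1
    have h3 : δ' ^ 2 = δ' * δ' := sq δ'
    nlinarith
  · exact kronRect_sq_sub_two_eq_zero_of_odd hδ ho

/-- **BI Ex. 5.6's `e(7) = 28` re-derived structurally**: the lower bound `e(7) ≥ 7·4` from the odd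
anomaly at `δ = 3`, the upper bound from `k_7(4) > 0`. [cite: BurgisserIkenmeyer2017, Ex. 5.6] -/
theorem genericTensorMinimalDegree_seven_ge : 28 ≤ genericTensorMinimalDegree (Fin 7) ℂ :=
  le_genericTensorMinimalDegree_sq_sub_two_of_odd (δ := 3) le_rfl (by decide)

/-! #### Instances beyond BI's table (`m ≤ 16`): `δ = 5` and `δ = 6` -/

/-- `e(19) = 95`, `e(20) = 100`, `e(21) = 105`, `e(22) = 110`, `e(24) = 120`, `e(25) = 125`
(`δ = 5`; all of BI's kind `e'(m) = 5`), and `138 ≤ e(23)` (the odd anomaly `5 ∉ E'(23)`).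
[cite: BurgisserIkenmeyer2017, Ex. 5.6 and Problem 5.19] -/
theorem genericTensorMinimalDegree_delta_five :
    genericTensorMinimalDegree (Fin 19) ℂ = 95 ∧ genericTensorMinimalDegree (Fin 20) ℂ = 100 ∧
    genericTensorMinimalDegree (Fin 21) ℂ = 105 ∧ genericTensorMinimalDegree (Fin 22) ℂ = 110 ∧
    genericTensorMinimalDegree (Fin 24) ℂ = 120 ∧ genericTensorMinimalDegree (Fin 25) ℂ = 125 ∧
    138 ≤ genericTensorMinimalDegree (Fin 23) ℂ :=
  ⟨genericTensorMinimalDegree_sq_sub_six (δ := 5) (by norm_num),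
    genericTensorMinimalDegree_sq_sub_five (δ := 5) (by norm_num),
    genericTensorMinimalDegree_sq_sub_four (δ := 5) (by norm_num),
    genericTensorMinimalDegree_sq_sub_three (δ := 5) (by norm_num),
    genericTensorMinimalDegree_sq_sub_one (δ := 5) (by norm_num),
    BI2017_thm_5_9_part3_minimalDegree 5 (by norm_num),
    le_genericTensorMinimalDegree_sq_sub_two_of_odd (δ := 5) (by norm_num) (by decide)⟩

/-- `e(30) = 180`, `e(31) = 186`, `e(32) = 192`, `e(33) = 198`, `e(34) = 204`, `e(35) = 210`,
`e(36) = 216` (`δ = 6`, even: no anomaly). [cite: BurgisserIkenmeyer2017, Ex. 5.6 and Problem 5.19] -/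
theorem genericTensorMinimalDegree_delta_six :
    genericTensorMinimalDegree (Fin 30) ℂ = 180 ∧ genericTensorMinimalDegree (Fin 31) ℂ = 186 ∧
    genericTensorMinimalDegree (Fin 32) ℂ = 192 ∧ genericTensorMinimalDegree (Fin 33) ℂ = 198 ∧
    genericTensorMinimalDegree (Fin 34) ℂ = 204 ∧ genericTensorMinimalDegree (Fin 35) ℂ = 210 ∧
    genericTensorMinimalDegree (Fin 36) ℂ = 216 :=
  ⟨genericTensorMinimalDegree_sq_sub_six (δ := 6) (by norm_num),
    genericTensorMinimalDegree_sq_sub_five (δ := 6) (by norm_num),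
    genericTensorMinimalDegree_sq_sub_four (δ := 6) (by norm_num),
    genericTensorMinimalDegree_sq_sub_three (δ := 6) (by norm_num),
    genericTensorMinimalDegree_sq_sub_two_of_even (δ := 6) (by norm_num) (by decide),
    genericTensorMinimalDegree_sq_sub_one (δ := 6) (by norm_num),
    BI2017_thm_5_9_part3_minimalDegree 6 (by norm_num)⟩

end MinimalDegree

/-! ### 4. The general near-square principle and the boxes `δ = 6, 7, 8` -/

section Principle

/-- **The near-square principle: `e(δ² - j) = (δ² - j)·δ` whenever `k_j(δ) > 0` and `j + 2 ≤ 2δ`.**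
The complement symmetry turns `k_j(δ) > 0` into `k_{δ²-j}(δ) > 0`, and `(δ-1)² < δ² - j` (i.e.
`j ≤ 2δ - 2`) locates the minimum of `E(δ²-j) ∖ {0}` (`genericTensorMinimalDegree_eq_of_kronRect_pos`).
[cite: BurgisserIkenmeyer2017, §5 eq. (5.2) and Ex. 5.6] -/
theorem genericTensorMinimalDegree_sq_sub_eq {δ j : ℕ} (hj : j + 2 ≤ 2 * δ)
    (hpos : 0 < kronRect ℂ j δ) :
    genericTensorMinimalDegree (Fin (δ * δ - j)) ℂ = (δ * δ - j) * δ := by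
  have hδ : 1 ≤ δ := by omega
  have hjlt : j < δ * δ := by nlinarith
  refine genericTensorMinimalDegree_eq_of_kronRect_pos (Nat.sub_pos_of_lt hjlt) (by omega) ?_
    (sq_pred_lt_sq_sub hj hδ)
  rwa [← kronRect_eq_kronRect_sq_sub hjlt.le]

/-- **`δ ∈ E'(δ² - j)` whenever `δ ∈ E'(j)`** (`j ≤ δ²`): the complement symmetry in positivity form.
[cite: BurgisserIkenmeyer2017, §5 eq. (5.2)] -/
theorem kronRect_sq_sub_pos {δ j : ℕ} (hj : j ≤ δ * δ) (hpos : 0 < kronRect ℂ j δ) :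
    0 < kronRect ℂ (δ * δ - j) δ := by
  rwa [← kronRect_eq_kronRect_sq_sub hj]

/-- `e(27) = 162` and `e(28) = 168` (`δ = 6`: `k_9(6), k_8(6) > 0` from `k_9(3) = k_8(3) = 1` by the
semigroup property `kronRect_add_pos`). The neighbours `e(26)` (`⇐ k_10(6) > 0`) and `e(29)`
(`⇐ k_7(6) > 0`) wait on atoms of BI Ex. 5.6's shape clause.
[cite: BurgisserIkenmeyer2017, Ex. 5.6 and Problem 5.19] -/
theorem genericTensorMinimalDegree_delta_six' :
    genericTensorMinimalDegree (Fin 27) ℂ = 162 ∧ genericTensorMinimalDegree (Fin 28) ℂ = 168 :=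
  ⟨genericTensorMinimalDegree_sq_sub_eq (δ := 6) (j := 9) (by norm_num)
      (kronRect_add_pos (δ₁ := 3) (δ₂ := 3) (by norm_num)
        (by rw [BI2017_rem_5_18_squares.2.1]; norm_num) (by rw [BI2017_rem_5_18_squares.2.1]; norm_num)),
    genericTensorMinimalDegree_sq_sub_eq (δ := 6) (j := 8) (by norm_num)
      (kronRect_add_pos (δ₁ := 3) (δ₂ := 3) (by norm_num) kronRect_eight_three_pos
        kronRect_eight_three_pos)⟩

/-- The box `δ = 7`: `e(40) = 280` (`k_9(7) = k_9(3+4) > 0` by `k_9(3) = 1`, `k_9(4) = 14`),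
`e(42) = 294` (`k_7(7) > 0`), `e(43) = 301`, `e(44) = 308`, `e(45) = 315`, `e(46) = 322`,
`e(48) = 336`, `e(49) = 343`, and the odd anomaly `376 ≤ e(47)`. (`e(41)`, `e(39)`, `e(38)`, `e(37)`
wait on `k_8(7), k_10(7), k_11(7), k_12(7) > 0`.) [cite: BurgisserIkenmeyer2017, Ex. 5.6 and Problem 5.19] -/
theorem genericTensorMinimalDegree_delta_seven :
    genericTensorMinimalDegree (Fin 40) ℂ = 280 ∧ genericTensorMinimalDegree (Fin 42) ℂ = 294 ∧
    genericTensorMinimalDegree (Fin 43) ℂ = 301 ∧ genericTensorMinimalDegree (Fin 44) ℂ = 308 ∧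
    genericTensorMinimalDegree (Fin 45) ℂ = 315 ∧ genericTensorMinimalDegree (Fin 46) ℂ = 322 ∧
    genericTensorMinimalDegree (Fin 48) ℂ = 336 ∧ genericTensorMinimalDegree (Fin 49) ℂ = 343 ∧
    376 ≤ genericTensorMinimalDegree (Fin 47) ℂ :=
  ⟨genericTensorMinimalDegree_sq_sub_eq (δ := 7) (j := 9) (by norm_num)
      (kronRect_add_pos (δ₁ := 3) (δ₂ := 4) (by norm_num)
        (by rw [BI2017_rem_5_18_squares.2.1]; norm_num) (by rw [kronRect_nine_four]; norm_num)),
    genericTensorMinimalDegree_sq_sub_eq (δ := 7) (j := 7) (by norm_num) (kronRect_self_pos 7 (by norm_num)),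
    genericTensorMinimalDegree_sq_sub_six (δ := 7) (by norm_num),
    genericTensorMinimalDegree_sq_sub_five (δ := 7) (by norm_num),
    genericTensorMinimalDegree_sq_sub_four (δ := 7) (by norm_num),
    genericTensorMinimalDegree_sq_sub_three (δ := 7) (by norm_num),
    genericTensorMinimalDegree_sq_sub_one (δ := 7) (by norm_num),
    BI2017_thm_5_9_part3_minimalDegree 7 (by norm_num),
    le_genericTensorMinimalDegree_sq_sub_two_of_odd (δ := 7) (by norm_num) (by decide)⟩

/-- `k_j(8) > 0` for `1 ≤ j ≤ 14`: `8 = 4 + 4` and the tree's values `k_j(4) > 0` (`j ≠ 8`; for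
`j = 8` the square `k_8(8) > 0`). [cite: BurgisserIkenmeyer2017, Ex. 5.6 and Rem. 5.18] -/
theorem kronRect_eight_pos_of_le_fourteen {j : ℕ} (h1 : 1 ≤ j) (h14 : j ≤ 14) : 0 < kronRect ℂ j 8 := by
  have key : ∀ j', 0 < j' → 0 < kronRect ℂ j' 4 → 0 < kronRect ℂ j' 8 :=
    fun j' hj' h => kronRect_add_pos (δ₁ := 4) (δ₂ := 4) hj' h h
  interval_cases j
  · exact key 1 one_pos (kronRect_one_pos 4)
  · exact key 2 two_pos (by rw [kronRect_two_four]; norm_num)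
  · exact key 3 (by norm_num) (kronRect_three_pos (by norm_num))
  · exact key 4 (by norm_num) (kronRect_four_pos (by norm_num))
  · exact key 5 (by norm_num) (by rw [kronRect_five_four]; norm_num)
  · exact key 6 (by norm_num) (by rw [kronRect_six_four]; norm_num)
  · exact key 7 (by norm_num) kronRect_seven_four_pos
  · exact kronRect_self_pos 8 (by norm_num)
  · exact key 9 (by norm_num) (by rw [kronRect_nine_four]; norm_num)
  · exact key 10 (by norm_num) (by rw [kronRect_ten_four]; norm_num)
  · exact key 11 (by norm_num) (by rw [kronRect_eleven_four]; norm_num)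
  · exact key 12 (by norm_num) (by rw [kronRect_twelve_four]; norm_num)
  · exact key 13 (by norm_num) (by rw [kronRect_thirteen_four]; norm_num)
  · exact key 14 (by norm_num) (by rw [kronRect_fourteen_four]; norm_num)

/-- **The box `δ = 8` is complete: `e(m) = 8m` for every `50 ≤ m ≤ 64`** (`m = 64 - j`, `j ≤ 14`,
`k_j(8) > 0`; `m = 64` is Thm. 5.9 (3)). [cite: BurgisserIkenmeyer2017, Ex. 5.6, Thm. 5.9 (3) and Problem 5.19] -/
theorem genericTensorMinimalDegree_eq_of_fifty_le {m : ℕ} (h50 : 50 ≤ m) (h64 : m ≤ 64) :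
    genericTensorMinimalDegree (Fin m) ℂ = m * 8 := by
  obtain ⟨j, hj, rfl⟩ : ∃ j, j ≤ 14 ∧ m = 8 * 8 - j := ⟨64 - m, by omega, by omega⟩
  rcases Nat.eq_zero_or_pos j with rfl | hj1
  · exact BI2017_thm_5_9_part3_minimalDegree 8 (by norm_num)
  · exact genericTensorMinimalDegree_sq_sub_eq (δ := 8) (by omega)
      (kronRect_eight_pos_of_le_fourteen hj1 hj)

end Principle

end Literature.Computability.AlgebraicComplexity
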